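import Mathlib
import Summits.SmoothPoincare4.SmoothPoincare4.Theorems.CylinderEntropyCylinderRungTwoKCertDefs
import HarnessLib

/-!
# Kernel certificate checker for `stub_certMid`, III-b: boxes, leaf test, script replay, validations, covers

Infrastructure file for the kernel-clean discharge of the registered stub `stub_certMid` of crux stmt-SmoothPoincare4-7631
(`Summit.SmoothPoincare4.SmoothPoincare4.Theses.CylinderEntropy.CylinderRungTwo`, line `killing-flux`).  Second half of the
checker definitions (`…KCertDefs` holds cells, tables, scaled integers, the fixed-point cosine and the end-point data):
box data and the per-atom enclosures, the zeroth-order and corner leaf tests, the script-driven bisection `run`, the cell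
validations, the root partition `subBox`, `runList` and `coverOK`.  Soundness is proved in the `…KCertSound*` files.
-/

-- the registered namespace `Summit.SmoothPoincare4.SmoothPoincare4.…` repeats a component
set_option linter.dupNamespace false

namespace Summit.SmoothPoincare4.SmoothPoincare4.Cruxes.CylinderRungTwo.KillingFlux

namespace KCert


open Summit.SmoothPoincare4.SmoothPoincare4.Theorems.CylinderEntropySliceIsolation.Cert
open Literature.Analysis.ValidatedNumerics.NumericsMP (MI)

/-! ### Boxes -/

/-- The data of a box `[u1, u2] × [t1, t2]`: end-point data and the four scaled corner bounds `sup_T E_T ≤ e··` at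
`(u1,t1)`, `(u1,t2)`, `(u2,t1)`, `(u2,t2)`. [folklore] -/
structure BoxD where
  /-- data at `u1` -/
  U1 : UD
  /-- data at `u2` -/
  U2 : UD
  /-- data at `t1` -/
  T1 : TD
  /-- data at `t2` -/
  T2 : TD
  /-- corner bound at `(u1, t1)` -/
  e11 : ℤ
  /-- corner bound at `(u1, t2)` -/
  e12 : ℤ
  /-- corner bound at `(u2, t1)` -/
  e21 : ℤ
  /-- corner bound at `(u2, t2)` -/
  e22 : ℤ

/-- Maximum of the scaled `expf` over the grid indices `ia ≤ i ≤ ib`. [folklore] -/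
def maxExpfS (tab : List TabE) (ia ib : ℕ) : ℤ :=
  ((tab.drop ia).take (ib + 1 - ia)).foldl (fun m e => max m (zhi64 e.expf)) 0

/-- Minimum of the scaled `cello` over the grid indices `ia ≤ i < ib`, starting from `z`. [folklore] -/
def minCelloS (tab : List TabE) (ia ib : ℕ) (z : ℤ) : ℤ :=
  ((tab.drop ia).take (ib - ia)).foldl (fun m e => min m (zlo64 e.cello)) z

/-- Scaled enclosure of an atom's zonal factor over `θ ∈ [t1, min t2 π]`. [folklore] -/
def zRange (tab : List TabE) (T1 T2 : TD) (tfl1 tfl2 hup1 : ℤ) : MI :=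
  let ia1 := T1.ia
  let ia2 := T2.ia
  let lo : ℤ :=
    if ia1 = ia2 then min tfl1 tfl2
    else min (min tfl1 tfl2) (minCelloS tab ia1 ia2 (zlo64 (tab.getD ia2 tabD).zlo))
  let hiMono := zhi64 (tab.getD ia1 tabD).zhi
  let hiConv := cdivZ (hup1 * maxExpfS tab ia1 T1.ib) S64
  ⟨lo, min hiMono hiConv⟩

/-- Rational enclosure of `(u - σ)/(2τ)` for `u ∈ [u1, u2]`, `τ ∈ [tlo, thi]`. [folklore] -/
def kRange (a : KAtom) (u1 u2 : ℚ) : ℚ × ℚ :=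
  let n1 := u1 - a.σ
  let n2 := u2 - a.σ
  (if 0 ≤ n1 then n1 / (2 * a.thi) else n1 / (2 * a.tlo), if 0 ≤ n2 then n2 / (2 * a.tlo) else n2 / (2 * a.thi))

/-- Per-atom contributions on a box: `(scaled lower bound of w·G·Z over the box, enclosure of ∂_u, enclosure of ∂_θ)`.
[folklore] -/
def atomBox (B : BoxD) (a : KAtom) (tab : List TabE) (glo1 glo2 ghi1 ghi2 tfl1 tfl2 hup1 : ℤ) : ℤ × MI × MI :=
  let gfar := min glo1 glo2
  let gnear : ℤ := if B.U1.u ≤ a.σ ∧ a.σ ≤ B.U2.u then (S64 : ℤ) else max ghi1 ghi2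
  let Z := zRange tab B.T1 B.T2 tfl1 tfl2 hup1
  let GZ : MI := MI.mul S64 ⟨gfar, gnear⟩ Z
  let kR := kRange a B.U1.u B.U2.u
  let W : MI := ofQ a.w
  let dU := MI.mul S64 (MI.mul S64 GZ ⟨zlo64 (-kR.2), zhi64 (-kR.1)⟩) W
  let dR : MI := ⟨zlo64 ((tab.getD B.T1.ia tabD).mlo - B.T2.t / (2 * a.tlo)),
    zhi64 ((tab.getD B.T2.ib tabD).mhi - B.T1.t / (2 * a.thi))⟩
  let dT := MI.mul S64 (MI.mul S64 GZ dR) W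
  (mul3lo (zlo64 a.w) gfar Z.lo, dU, dT)

/-- Fold of `atomBox` over the atoms. [folklore] -/
def atomsBox (B : BoxD) :
    List KAtom → List (List TabE) → List ℤ → List ℤ → List ℤ → List ℤ → List ℤ → List ℤ → List ℤ → ℤ × MI × MI
  | a :: as, tb :: tbs, g1 :: g1s, g2 :: g2s, h1 :: h1s, h2 :: h2s, f1 :: f1s, f2 :: f2s, hp :: hps =>
    let r := atomBox B a tb g1 g2 h1 h2 f1 f2 hp
    let s := atomsBox B as tbs g1s g2s h1s h2s f1s f2s hps
    (r.1 + s.1, r.2.1.add s.2.1, r.2.2.add s.2.2)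
  | _, _, _, _, _, _, _, _, _ => (0, ⟨0, 0⟩, ⟨0, 0⟩)

/-- The rational kernel-side quantities of a box: `(EhiB, EloB, Ta, Tb)` from `e^u ∈ [xa, xb]`, `cos θ ∈ [cl, ch]`. [folklore] -/
def eBoxQ (C : KCell) (xa xb cl ch : ℚ) : ℚ × ℚ × ℚ × ℚ :=
  let p := C.prec
  let r := clampQ ch xa xb
  let Qlo := (r - ch) ^ 2 + (1 - ch ^ 2)
  let Qhi := max (xa ^ 2 + 1 - 2 * xa * cl) (xb ^ 2 + 1 - 2 * xb * cl)
  let Ta := clampQ (Qlo / 8) C.T1 C.T2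
  let Tb := clampQ (Qhi / 8) C.T1 C.T2
  let EhiB := rup (xb ^ 4 * expHi (-Qlo / (4 * Ta)) p / (6 * Ta ^ 2)) p
  let EloB := rdn (xa ^ 4 * min (expLo (-Qhi / (4 * Ta)) p / Ta ^ 2) (expLo (-Qhi / (4 * Tb)) p / Tb ^ 2) / 6) p
  (EhiB, EloB, Ta, Tb)

/-- The rational kernel-side quantities `(EhiB, EloB, Ta, Tb)` of a box from its end-point data. [folklore] -/
def leafE (C : KCell) (B : BoxD) : ℚ × ℚ × ℚ × ℚ :=
  eBoxQ C (toQ B.U1.x.lo) (toQ B.U2.x.hi) (toQ B.T2.cs.lo) (toQ B.T1.cs.hi)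

/-- Enclosure of `∂_u E_T = E_T · (4 - x (x - cos θ)/(2T))` over the box, for `T` in the envelope range. [folklore] -/
def dEuBox (B : BoxD) (E : ℚ × ℚ × ℚ × ℚ) : MI :=
  let Eiv : MI := ⟨zlo64 E.2.1, zhi64 E.1⟩
  let X : MI := ⟨B.U1.x.lo, B.U2.x.hi⟩
  let invT : MI := ⟨zlo64 (1 / (2 * E.2.2.2)), zhi64 (1 / (2 * E.2.2.1))⟩
  MI.mul S64 Eiv ((MI.ofInt S64 4).sub (MI.mul S64 (MI.mul S64 X (X.sub ⟨B.T2.cs.lo, B.T1.cs.hi⟩)) invT))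

/-- Enclosure of `∂_θ E_T = -E_T · x · sin θ/(2T)` over the box, for `T` in the envelope range. [folklore] -/
def dEtBox (C : KCell) (B : BoxD) (E : ℚ × ℚ × ℚ × ℚ) : MI :=
  let Eiv : MI := ⟨zlo64 E.2.1, zhi64 E.1⟩
  let X : MI := ⟨B.U1.x.lo, B.U2.x.hi⟩
  let invT : MI := ⟨zlo64 (1 / (2 * E.2.2.2)), zhi64 (1 / (2 * E.2.2.1))⟩
  let clq := toQ B.T2.cs.lo
  let chq := toQ B.T1.cs.hi
  let cmax2 := max (clq ^ 2) (chq ^ 2)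
  let cmin2 : ℚ := if 0 ≤ clq then clq ^ 2 else if chq ≤ 0 then chq ^ 2 else 0
  let Sn : MI := ⟨zlo64 (ksqrtLo (1 - cmax2) C.prec), zhi64 (ksqrtHi (1 - cmin2) C.prec)⟩
  (MI.mul S64 (MI.mul S64 (MI.mul S64 Eiv X) Sn) invT).neg

/-- The smallest certified corner margin `rCorner - eCorner` of a box. [folklore] -/
def dminBox (C : KCell) (B : BoxD) : ℤ :=
  min (min (rCorner C B.U1 B.T1 - B.e11) (rCorner C B.U1 B.T2 - B.e12))
    (min (rCorner C B.U2 B.T1 - B.e21) (rCorner C B.U2 B.T2 - B.e22))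

/-- The second-order (corner) test of a box, given the atom enclosures `A` and the kernel quantities `E`:
`hu · sup|∂_u(R - E)| + ht · sup|∂_θ(R - E)| ≤ min over corners of (R - E)` (scaled, outward rounded). [folklore] -/
def test1 (C : KCell) (B : BoxD) (A : ℤ × MI × MI) (E : ℚ × ℚ × ℚ × ℚ) : Bool :=
  let Gu := (A.2.1.sub (dEuBox B E)).absHi
  let Gt := (A.2.2.sub (dEtBox C B E)).absHi
  let hu := zhi64 ((B.U2.u - B.U1.u) / 2)
  let ht := zhi64 ((B.T2.t - B.T1.t) / 2)
  decide (0 ≤ hu) && decide (0 ≤ ht) && decide (0 < E.2.2.1) &&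
    decide (cdivZ (hu * Gu) S64 + cdivZ (ht * Gt) S64 ≤ dminBox C B)

/-- The leaf test of a box: zeroth-order test `sup E ≤ inf R`, else the second-order corner test. [folklore] -/
def leafOK (C : KCell) (tabs : List (List TabE)) (B : BoxD) : Bool :=
  let E := leafE C B
  let A := atomsBox B C.atoms tabs B.U1.glo B.U2.glo B.U1.ghi B.U2.ghi B.T1.tfl B.T2.tfl B.T1.hup
  decide (zhi64 E.1 ≤ zlo64 C.c + A.1) || test1 C B A E

/-- The script-driven bisection: consumes base-3 digits of `code` in preorder (`0` leaf, `1` split in `u`, `2` split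
in `θ`); returns the unconsumed part of the script on success. [folklore] -/
def run (C : KCell) (tabs : List (List TabE)) : ℕ → ℕ → BoxD → Option ℕ
  | 0, _, _ => none
  | fuel + 1, code, B =>
    match code % 3 with
    | 0 => if leafOK C tabs B then some (code / 3) else none
    | 1 =>
      let um := (B.U1.u + B.U2.u) / 2
      let Um := mkUD C um
      let em1 := eCorner C Um B.T1
      let em2 := eCorner C Um B.T2
      match run C tabs fuel (code / 3) ⟨B.U1, Um, B.T1, B.T2, B.e11, B.e12, em1, em2⟩ with
      | some code' => run C tabs fuel code' ⟨Um, B.U2, B.T1, B.T2, em1, em2, B.e21, B.e22⟩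
      | none => none
    | _ =>
      let tm := (B.T1.t + B.T2.t) / 2
      let Tm := mkTDh C tabs tm B.T1.ia B.T2.ia B.T1.ib B.T2.ib
      let e1m := eCorner C B.U1 Tm
      let e2m := eCorner C B.U2 Tm
      match run C tabs fuel (code / 3) ⟨B.U1, B.U2, B.T1, Tm, B.e11, e1m, B.e21, e2m⟩ with
      | some code' => run C tabs fuel code' ⟨B.U1, B.U2, Tm, B.T2, e1m, B.e12, e2m, B.e22⟩
      | none => none

/-! ### Cells and covers -/

/-- Atom validation: `0 < q < 1`, `0 ≤ w`, `0 < tlo ≤ thi`, `q ≤ expLo(-2 tlo)` (so `tlo ≤ τ`), `expHi(-2 thi) ≤ q`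
(so `τ ≤ thi`), and the sharp-tail ratio condition. [folklore] -/
def atomOK (C : KCell) (a : KAtom) : Bool :=
  decide (0 < a.q) && decide (a.q < 1) && decide (0 ≤ a.w) && decide (0 < a.tlo) && decide (a.tlo ≤ a.thi) &&
    decide (a.q ≤ expLo (-2 * a.tlo) C.prec) && decide (expHi (-2 * a.thi) C.prec ≤ a.q) && sharpOK a.q a.K

/-- Validation of all atoms. [folklore] -/
def atomsOK (C : KCell) : List KAtom → Bool
  | [] => true
  | a :: as => atomOK C a && atomsOK C as

/-- Sum of the weights. [folklore] -/
def weightSum : List KAtom → ℚ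
  | [] => 0
  | a :: as => a.w + weightSum as

/-- The `u`-tails (verbatim the tree's `Cert.tailsOK`): below `uMin` the kernel is `≤ (6T₁²)⁻¹ e^{4 uMin} ≤ c`; above
`uMax` it is decreasing in `u` and `≤ c`. [folklore] -/
def tailsOK (C : KCell) : Bool :=
  let eU := expLo C.uMax C.prec
  decide (expHi (4 * C.uMin) C.prec / (6 * C.T1 ^ 2) ≤ C.c) &&
    decide (1 ≤ eU) && decide (8 * C.T2 ≤ eU * (eU - 1)) &&
      decide (expHi (4 * C.uMax - (eU - 1) ^ 2 / (4 * C.T2)) C.prec / (6 * C.T1 ^ 2) ≤ C.c)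

/-- Validation of an interior grid point: `0 ≤ tlo ≤ thi < πlo`, `-1 ≤ s ≤ 1`, and the certified arccos enclosure
`cos thi ≤ s ≤ cos tlo`. [folklore] -/
def gridPtOK (g : GridPt) : Bool :=
  decide (0 ≤ g.tlo) && decide (g.tlo ≤ g.thi) && decide (g.thi < piLo) && decide (-1 ≤ g.s) && decide (g.s ≤ 1) &&
    decide ((cosI g.thi).hi ≤ zlo64 g.s) && decide (zhi64 g.s ≤ (cosI g.tlo).lo)

/-- Validation of the grid: first point `(1, 0, 0)`, last point `(-1, πlo, πhi)`, interior points certified, and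
strictly separated enclosures `thi_i < tlo_{i+1}`. [folklore] -/
def gridOK (C : KCell) : Bool :=
  let n := C.grid.length
  decide (2 ≤ n) &&
    (decide ((C.grid.getD 0 gridD).s = 1) && decide ((C.grid.getD 0 gridD).tlo = 0) && decide ((C.grid.getD 0 gridD).thi = 0)) &&
    (decide ((C.grid.getD (n - 1) gridD).s = -1) && decide ((C.grid.getD (n - 1) gridD).tlo = piLo) &&
      decide ((C.grid.getD (n - 1) gridD).thi = piHi)) &&
    (List.range (n - 2)).all (fun i => gridPtOK (C.grid.getD (i + 1) gridD)) &&
    (List.range (n - 1)).all (fun i => decide ((C.grid.getD i gridD).thi < (C.grid.getD (i + 1) gridD).tlo))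

/-- The sub-box `(k, l)` of the uniform `KU × KT` partition of the root box `[uMin, uMax] × [0, πhi]`, with its data
(end-point data and certified corner values). [folklore] -/
def subBox (C : KCell) (tabs : List (List TabE)) (KU KT k l : ℕ) : BoxD :=
  let u1 := C.uMin + (C.uMax - C.uMin) * (k : ℚ) / (KU : ℚ)
  let u2 := C.uMin + (C.uMax - C.uMin) * ((k : ℚ) + 1) / (KU : ℚ)
  let t1 := piHi * (l : ℚ) / (KT : ℚ)
  let t2 := piHi * ((l : ℚ) + 1) / (KT : ℚ)
  let U1 := mkUD C u1
  let U2 := mkUD C u2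
  let T1 := mkTD C tabs t1
  let T2 := mkTD C tabs t2
  ⟨U1, U2, T1, T2, eCorner C U1 T1, eCorner C U1 T2, eCorner C U2 T1, eCorner C U2 T2⟩

/-- The cheap validations of a cell against the mass bound `M` (everything but the tables and the bisection):
`0 < T₁ ≤ T₂`, `0 ≤ c`, `uMin ≤ uMax`, atoms, mass, `u`-tails, grid. [folklore] -/
def validOK (C : KCell) (M : ℚ) : Bool :=
  decide (0 < C.T1) && decide (C.T1 ≤ C.T2) && decide (0 ≤ C.c) && decide (C.uMin ≤ C.uMax) &&
    atomsOK C C.atoms && decide (weightSum C.atoms + C.c ≤ M) && tailsOK C && gridOK C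

/-- Replay of a list of sub-box scripts `(k, l, fuel, code)` of the `KU × KT` partition. [folklore] -/
def runList (C : KCell) (tabs : List (List TabE)) (KU KT : ℕ) (items : List (ℕ × ℕ × ℕ × ℕ)) : Bool :=
  items.all fun it => decide (run C tabs it.2.2.1 it.2.2.2 (subBox C tabs KU KT it.1 it.2.1) = some 0)

/-- Contiguity of a cover of `[a, b]` by the `T`-ranges of a list of cells. [folklore] -/
def coverOK : List KCell → ℚ → ℚ → Bool
  | [], _, _ => false
  | [C], a, b => decide (C.T1 ≤ a) && decide (b ≤ C.T2)
  | C :: C' :: rest, a, b => decide (C.T1 ≤ a) && decide (C'.T1 ≤ C.T2) && coverOK (C' :: rest) C'.T1 b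

end KCert

/-- Registered sub-goal marker `stub_certMid_part3` of crux stmt-SmoothPoincare4-7631 (helper file 3 of the kernel-clean
`stub_certMid`, line killing-flux): the scale rounding of the checker `KCert` (integer layer). [folklore] -/
theorem stub_certMid_part3 : ∀ q : ℚ, ((⌊q * 18446744073709551616⌋ : ℤ) : ℚ) ≤ q * 18446744073709551616 :=
  fun _ => Int.floor_le _

end Summit.SmoothPoincare4.SmoothPoincare4.Cruxes.CylinderRungTwo.KillingFlux
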